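import Literature.NumberTheory.EllipticCurves.IwasawaEisensteinTwistedCocycleReadoutProofs
import HarnessLib

/-!
# `A_{m,k}`-twisted cocycles whose coordinate classes vanish on `K_∞` are twisted coboundaries
# (injectivity of `H¹(K, M ⊗ A_{m,k}(ψ⁻¹)) → H¹(K_∞, M)`-coordinates when `(A ⊗ M)^{Gal(K̄/K_∞)} = 0`; proofs only)

Topic `Literature/NumberTheory/EllipticCurves` (sequel to `IwasawaEisensteinTwistedCocycleReadoutProofs`; cell `pub/bsd-print-x9`,
blueprint HOME/p2/S1-DISCRETE-CONTROL §1(c), file F3 — the INJECTIVITY half).  THEOREMS ONLY; no definition, no named fact,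
no instance, no `sorry`.

Setting of the readout files: `κ` a `ℤ_p`-extension of `K`, `M` a discrete `Γ_K`-module killed by `p^k`, `A = A_{m,k}`,
`χ : Γ_K → A` multiplicative and trivial on `H := Gal(K̄/K_∞) = ker κ`, `f : Γ_K → A ⊗ M` a twisted crossed homomorphism
(`f(στ) = f(σ) + χ(σ)·(1⊗σ) f(τ)`), `φ_j` the coordinate cocycles of `f|_H` (`λ_k([π_j^*] · f)`).
**Theorem (`exists_eq_twistedCoboundary_of_forall_oneCocycleClass_eq_zero`).** If `A ⊗ M` has no non-zero `H`-fixed vector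
(`∀ x, (∀ h ∈ H, (1⊗h) x = x) → x = 0`; for `M = E[p^k]` and `A` free this is `E(K_∞)[p] = 0`) and EVERY coordinate class
`[φ_j] ∈ H¹(K_∞, M)` vanishes, then `f` is a twisted coboundary: `∃ x, ∀ σ, f σ = χ(σ)·(1⊗σ) x − x`.
Steps: (1) `[φ_j] = 0` gives `v_j ∈ M` with `φ_j(h) = h v_j − v_j`; `x := Σ_i [T^i] ⊗ v_i` has `f(h) = (1⊗h)x − x` on `H`
(coordinates determine an element of `A ⊗ M`, `Twisted.eq_sum_tmul_tailReadout`); (2) `f' := f − ∂x` is a twisted crossed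
homomorphism vanishing on the NORMAL subgroup `H`, hence `(1⊗h) f'(g) = f'(hg) = f'(g·g⁻¹hg) = f'(g)`, so `f'(g)` is `H`-fixed,
so `f' = 0`.  This is the inflation–restriction injectivity `H¹(Γ_K/H, W^H) = 0 → H¹(Γ_K, W) ↪ H¹(H, W)` for `W = M ⊗ A(ψ⁻¹)`
with `W^H = 0`, at cocycle level and read in coordinates; with F2 it makes
`ι_{m,k} : H¹(K, A_q[p^k]) → H¹(K_∞, E[p^k])[ψ_m]` injective on the level of the full coordinate vector.

References: [NeukirchSchmidtWingberg2008] I.§6 (inflation–restriction, Prop. 1.6.7); [SerreGaloisCohomology1997] I.§2.6;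
[Howard2004HeegnerKolyvagin] Lemma 2.2.7 / Prop. 2.2.8 (the kernel of `H¹_{F_q}(K, A_q) → H¹_{F_Λ}(K, 𝐀)[q]`);
[GreenbergLNM1716] §4 p. 107.  BSD is not proved by any of this.
-/

noncomputable section

open CategoryTheory Literature.NumberTheory.EllipticCurves Literature.NumberTheory.GaloisRepresentations

universe u

namespace Literature.NumberTheory.EllipticCurves

namespace IwasawaDual

open IwasawaAlgebra

section Injective

variable {K : Type u} [Field K] {p : ℕ} [hp : Fact p.Prime] (κ : ZpExtension K p)
variable {m : ℕ} (hm : 1 ≤ m) (k : ℕ)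
variable {M : Type u} [AddCommGroup M] [DistribMulAction (Field.absoluteGaloisGroup K) M]
  [TopologicalSpace M] [DiscreteTopology M] (hM : ∀ x : M, (p ^ k) • x = 0)

omit [TopologicalSpace M] [DiscreteTopology M] in
/-- **Coordinates of `(1⊗h) x − x` for `x = Σ_i [T^i] ⊗ v_i`**: `λ_k([π_j^*]((1⊗σ)x − x)) = σ v_j − v_j`.
[cite: NeukirchSchmidtWingberg2008, I.§5] -/
theorem tailReadout_dualFamily_smul_mapEnd_sum_sub (σ : Field.absoluteGaloisGroup K) (v : Fin m → M) (j : Fin m) :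
    EisensteinCoeff.Twisted.tailReadout p hm k hM (EisensteinCoeff.dualFamily p hm k j •
      (CoeffExtension.mapEnd (DistribMulAction.toAddMonoidEnd _ M σ)
          (∑ i : Fin m, EisensteinCoeff.Twisted.tmul
            (Ideal.Quotient.mk _ ((PowerSeries.X : IwasawaAlgebra p) ^ (i : ℕ)) : EisensteinCoeff p m k) (v i)) -
        ∑ i : Fin m, EisensteinCoeff.Twisted.tmul
            (Ideal.Quotient.mk _ ((PowerSeries.X : IwasawaAlgebra p) ^ (i : ℕ)) : EisensteinCoeff p m k) (v i))) =
      σ • v j - v j := by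
  rw [smul_sub, map_sub, tailReadout_dualFamily_smul_mapEnd, EisensteinCoeff.Twisted.tailReadout_dualFamily_smul_sum]

omit [TopologicalSpace M] [DiscreteTopology M] in
/-- **A twisted crossed homomorphism vanishing on the normal subgroup `ker κ` takes `ker κ`-fixed values**:
`(1⊗h) f(g) = f(g)` for `h ∈ ker κ` (from `f(hg) = (1⊗h) f(g)` and `f(g·(g⁻¹hg)) = f(g)`).
[cite: NeukirchSchmidtWingberg2008, I.§6 (Prop. 1.6.7, inflation–restriction)] -/
theorem mapEnd_apply_eq_self_of_forall_mem_ker_eq_zero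
    (χ : Field.absoluteGaloisGroup K → EisensteinCoeff p m k) (hχker : ∀ σ ∈ κ.kerSubgroup, χ σ = 1)
    (f : Field.absoluteGaloisGroup K → EisensteinCoeff.Twisted p m k M)
    (hf : ∀ σ τ : Field.absoluteGaloisGroup K,
      f (σ * τ) = f σ + χ σ • CoeffExtension.mapEnd (DistribMulAction.toAddMonoidEnd _ M σ) (f τ))
    (hzero : ∀ h ∈ κ.kerSubgroup, f h = 0) (g h : Field.absoluteGaloisGroup K) (hh : h ∈ κ.kerSubgroup) :
    CoeffExtension.mapEnd (DistribMulAction.toAddMonoidEnd _ M h) (f g) = f g := by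
  -- `f (h g) = f h + χ h • (1⊗h) f g = (1⊗h) f g`
  have h1 : f (h * g) = CoeffExtension.mapEnd (DistribMulAction.toAddMonoidEnd _ M h) (f g) := by
    rw [hf, hzero h hh, hχker h hh, one_smul, zero_add]
  -- `h g = g (g⁻¹ h g)` with `g⁻¹ h g ∈ ker κ` (normal), and `f (g n) = f g` for `n ∈ ker κ`
  have hn : g⁻¹ * h * g ∈ κ.kerSubgroup := by
    have := Subgroup.Normal.conj_mem inferInstance h hh g⁻¹
    rwa [inv_inv] at this
  have h2 : f (h * g) = f g := by
    rw [show h * g = g * (g⁻¹ * h * g) by group, hf, hzero _ hn, map_zero, smul_zero, add_zero]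
  rw [← h1, h2]

omit [TopologicalSpace M] [DiscreteTopology M] in
/-- `f 1 = 0` for a twisted crossed homomorphism (`χ 1 = 1`). [cite: NeukirchSchmidtWingberg2008, I.§5] -/
theorem twisted_apply_one_eq_zero (χ : Field.absoluteGaloisGroup K → EisensteinCoeff p m k) (hχ1 : χ 1 = 1)
    (f : Field.absoluteGaloisGroup K → EisensteinCoeff.Twisted p m k M)
    (hf : ∀ σ τ : Field.absoluteGaloisGroup K,
      f (σ * τ) = f σ + χ σ • CoeffExtension.mapEnd (DistribMulAction.toAddMonoidEnd _ M σ) (f τ)) :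
    f 1 = 0 := by
  have h := hf 1 1
  rw [mul_one, hχ1, one_smul, mapEnd_toAddMonoidEnd_one] at h
  simpa using h

omit [TopologicalSpace M] [DiscreteTopology M] in
/-- **The twisted coboundary of `x`**, `σ ↦ χ(σ)·(1⊗σ) x − x`, is a twisted crossed homomorphism.
[cite: NeukirchSchmidtWingberg2008, I.§5] -/
theorem twistedCoboundary_mul (χ : Field.absoluteGaloisGroup K → EisensteinCoeff p m k)
    (hχmul : ∀ σ τ, χ (σ * τ) = χ σ * χ τ) (x : EisensteinCoeff.Twisted p m k M) (σ τ : Field.absoluteGaloisGroup K) :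
    (χ (σ * τ) • CoeffExtension.mapEnd (DistribMulAction.toAddMonoidEnd _ M (σ * τ)) x - x) =
      (χ σ • CoeffExtension.mapEnd (DistribMulAction.toAddMonoidEnd _ M σ) x - x) +
        χ σ • CoeffExtension.mapEnd (DistribMulAction.toAddMonoidEnd _ M σ)
          (χ τ • CoeffExtension.mapEnd (DistribMulAction.toAddMonoidEnd _ M τ) x - x) := by
  rw [hχmul, mapEnd_toAddMonoidEnd_mul, map_sub, map_smul, smul_sub, smul_smul]
  abel

/-- **Twisted cocycles with vanishing coordinate classes on `K_∞` are twisted coboundaries** (injectivity of the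
restriction to `K_∞` read in coordinates, when `A ⊗ M` has no non-zero `Gal(K̄/K_∞)`-fixed vector).
[cite: NeukirchSchmidtWingberg2008, I.§6 (Prop. 1.6.7)] [cite: Howard2004HeegnerKolyvagin, Lemma 2.2.7 / Prop. 2.2.8]
[cite: GreenbergLNM1716, §4 p. 107] -/
theorem exists_eq_twistedCoboundary_of_forall_oneCocycleClass_eq_zero
    (χ : Field.absoluteGaloisGroup K → EisensteinCoeff p m k)
    (hχmul : ∀ σ τ, χ (σ * τ) = χ σ * χ τ) (hχker : ∀ σ ∈ κ.kerSubgroup, χ σ = 1)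
    (hfix : ∀ x : EisensteinCoeff.Twisted p m k M,
      (∀ h ∈ κ.kerSubgroup, CoeffExtension.mapEnd (DistribMulAction.toAddMonoidEnd _ M h) x = x) → x = 0)
    (f : Field.absoluteGaloisGroup K → EisensteinCoeff.Twisted p m k M)
    (hf : ∀ σ τ : Field.absoluteGaloisGroup K,
      f (σ * τ) = f σ + χ σ • CoeffExtension.mapEnd (DistribMulAction.toAddMonoidEnd _ M σ) (f τ))
    (φ : Fin m → contOneCocycles (discreteTopRep κ.kerSubgroup M))
    (hφ : ∀ (j : Fin m) (h : κ.kerSubgroup), (φ j).1 h =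
      EisensteinCoeff.Twisted.tailReadout p hm k hM (EisensteinCoeff.dualFamily p hm k j • f h))
    (hφ0 : ∀ j : Fin m, oneCocycleClass _ (φ j) = 0) :
    ∃ x : EisensteinCoeff.Twisted p m k M, ∀ σ : Field.absoluteGaloisGroup K,
      f σ = χ σ • CoeffExtension.mapEnd (DistribMulAction.toAddMonoidEnd _ M σ) x - x := by
  -- (1) the principal vectors `v_j` of the coordinate classes and `x := Σ [T^i] ⊗ v_i`
  have hv : ∀ j : Fin m, ∃ v : M, ∀ h : κ.kerSubgroup, (φ j).1 h = (h : Field.absoluteGaloisGroup K) • v - v :=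
    fun j ↦ by
    obtain ⟨v, hv⟩ := (oneCocycleClass_eq_zero_iff _ (φ j)).mp (hφ0 j)
    exact ⟨v, fun h ↦ hv h⟩
  choose v hv using hv
  set x : EisensteinCoeff.Twisted p m k M := ∑ i : Fin m, EisensteinCoeff.Twisted.tmul
    (Ideal.Quotient.mk _ ((PowerSeries.X : IwasawaAlgebra p) ^ (i : ℕ)) : EisensteinCoeff p m k) (v i) with hx
  refine ⟨x, ?_⟩
  -- on `H = ker κ`: `f h = (1⊗h) x − x` (all coordinates agree)
  have hH : ∀ h ∈ κ.kerSubgroup, f h = CoeffExtension.mapEnd (DistribMulAction.toAddMonoidEnd _ M h) x - x := by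
    intro h hh
    rw [← sub_eq_zero]
    refine EisensteinCoeff.Twisted.eq_zero_of_forall_tailReadout_dualFamily_smul_eq_zero p hm k hM _ fun j ↦ ?_
    rw [smul_sub, map_sub, ← hφ j ⟨h, hh⟩, hv j ⟨h, hh⟩, hx, tailReadout_dualFamily_smul_mapEnd_sum_sub, sub_self]
  -- (2) `f' := f − ∂x` is a twisted crossed homomorphism vanishing on `H`, hence zero
  set f' : Field.absoluteGaloisGroup K → EisensteinCoeff.Twisted p m k M :=
    fun σ ↦ f σ - (χ σ • CoeffExtension.mapEnd (DistribMulAction.toAddMonoidEnd _ M σ) x - x) with hf'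
  have hf'mul : ∀ σ τ : Field.absoluteGaloisGroup K,
      f' (σ * τ) = f' σ + χ σ • CoeffExtension.mapEnd (DistribMulAction.toAddMonoidEnd _ M σ) (f' τ) := fun σ τ ↦ by
    simp only [hf']
    rw [hf σ τ, twistedCoboundary_mul k χ hχmul x σ τ]
    simp only [map_sub, smul_sub]
    abel
  have hf'zero : ∀ h ∈ κ.kerSubgroup, f' h = 0 := fun h hh ↦ by
    simp only [hf']
    rw [hH h hh, hχker h hh, one_smul, sub_self]
  have hf'eq : ∀ g, f' g = 0 := fun g ↦
    hfix _ fun h hh ↦ mapEnd_apply_eq_self_of_forall_mem_ker_eq_zero κ k χ hχker f' hf'mul hf'zero g h hh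
  intro σ
  have h := hf'eq σ
  simp only [hf'] at h
  rwa [sub_eq_zero] at h

end Injective

end IwasawaDual

end Literature.NumberTheory.EllipticCurves
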